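import Summits.PneNP.PneNP.Theorems.PeaWorstToAvg.Negative.AdviceElimLoadBearing
import Summits.PneNP.PneNP.Theorems.SzkEntropyPeaWorstToAvgOrbitPairRsrDefs
import Literature.Computability.Complexity.PolyTimeCountable
import Literature.Computability.Complexity.CodeFPLists
import Literature.Computability.Complexity.PolynomialEntropyApproximationDegOne

/-!
# PneNP / SzkEntropy — crux `PeaWorstToAvg` (stmt-PneNP-10777), negative side, line `orbit-pair-rsr`:
# `P`-uniformity of the families is LOAD-BEARING in `stub_orbitKit`

Drefute content for the skeleton `Cruxes/PeaWorstToAvg/Lines/orbit-pair-rsr.lean` (objects: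
`SzkEntropyPeaWorstToAvgOrbitPairRsrDefs.lean`), stub `stub_orbitKit : IsPUniform p₀ k → IsPUniform p₁ k →
(∀ s, DegLE 3 (p₀ s)) → (∀ s, DegLE 3 (p₁ s)) → (∀ s, s ≤ |p₀ s| ∧ s ≤ |p₁ s|) → Nonempty (OrbitKit p₀ p₁ k)`:

* `countable_uniformSamplers` / `false_of_injective_uniformSamplers` — uniform samplers (polynomial-time
  `RandAlg ℕ (List Bool)` with an HONEST polynomial coin budget) form a countable set (sampler analogue of
  `countable_uniformSchemes`, `AdviceElimLoadBearing.lean`), so `ℕ → Bool` does not inject into them.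
* `orbitKit_false_without_uniformity` — the stub WITHOUT `hu₀`, `hu₁` (degree bound and `≥ s` outputs kept) is
  FALSE: for the coordinate family `x ↦ (x₀,…,x_{s-1})` on both sides and thresholds `k_c (n+1) = [c n]`, a kit's
  planted sampler `samp false` outputs at `1ⁿ` only encodings of instances with threshold field `k_c (n+1)`
  (`samp_support`, injectivity of `PEAInst.encoding`), so it determines `c` — for every `c : ℕ → Bool`.
* `orbitKit_false_without_uniformity_yes` — the sharper form: dropping `hu₁` ALONE (with `hu₀` kept: the zero
  family with thresholds `0`, `P`-uniform by `isPUniform_zeroFam_zero`) already makes the stub FALSE: YES family =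
  coordinate map or zero map at size `n+1` according to `c n`; the zero-coin output of `samp true` is a CONSTANT
  map iff `¬ c n` (affine equivalence preserves constancy; the coordinate orbit separates `0` from `e₀`).
  Symmetric in the two sides.  So the kit's samplers must genuinely COMPUTE `⟨p_b^{n+1}, k(n+1)⟩` from `1ⁿ`:
  any proof of `stub_orbitKit` uses both `hu₀` and `hu₁`.

References: A. Bogdanov, L. Trevisan, *Average-Case Complexity*, FnT–TCS 2 (2006), Def. 2.1; S. Arora,
B. Barak, *Computational Complexity* (2009), §1.4, §6.2; J. Patarin, EUROCRYPT 1996 (IP2S: the orbits).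
-/

namespace Summit.PneNP.PneNP.Theorems

set_option linter.dupNamespace false -- `Summit.PneNP.PneNP.…`: summit = sub-problem name (D-0017)

open Literature.Computability.Complexity Literature.Computability.MetaComplexity
open _root_.Computability
open Summit.PneNP.PneNP.Cruxes.PeaWorstToAvg.OrbitPairRsr
open scoped ENNReal

/-! ### Uniform samplers are countable -/

/-- **Uniform samplers form a countable set**: the run maps of `IsPolyTime` samplers `1ⁿ ↦ x` are
polynomial-time computable functions (countably many, `countable_setOf_polyTimeComputable`) and honest coin
budgets are values of `ℕ[X]`. (Sampler analogue of `countable_uniformSchemes`.) [AroraBarakCC2009, §1.4;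
BogdanovTrevisan2006, Def. 2.1] -/
theorem countable_uniformSamplers :
    Set.Countable {A : RandAlg ℕ (List Bool) | A.IsPolyTime unaryEncodeNat (id : List Bool → List Bool) ∧
      ∃ c : Polynomial ℕ, ∀ ℓ, A.coinLen ℓ = c.eval ℓ} := by
  have h1 : Set.Countable {f : ℕ × List Bool → List Bool |
      PolyTimeComputable (fun p : ℕ × List Bool => boolPair (unaryEncodeNat p.1) p.2)
        (id : List Bool → List Bool) f} :=
    countable_setOf_polyTimeComputable _ Function.injective_id
  have h2 : Set.Countable {g : ℕ → ℕ | ∃ c : Polynomial ℕ, ∀ ℓ, g ℓ = c.eval ℓ} := by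
    haveI : Countable (Polynomial ℕ) :=
      (AddMonoidAlgebra.coeff_injective.comp Polynomial.toFinsupp_injective).countable
    have hsub : {g : ℕ → ℕ | ∃ c : Polynomial ℕ, ∀ ℓ, g ℓ = c.eval ℓ} ⊆
        Set.range (fun c : Polynomial ℕ => fun ℓ => c.eval ℓ) := by
      rintro g ⟨c, hc⟩
      exact ⟨c, (funext hc).symm⟩
    exact (Set.countable_range _).mono hsub
  refine Set.MapsTo.countable_of_injOn
    (f := fun A : RandAlg ℕ (List Bool) => (Function.uncurry A.run, A.coinLen)) ?_ ?_ (h1.prod h2)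
  · intro A hA
    exact Set.mk_mem_prod hA.1.1 hA.2
  · intro A _ A' _ h
    obtain ⟨r, c⟩ := A
    obtain ⟨r', c'⟩ := A'
    simp only [Prod.mk.injEq, RandAlg.mk.injEq] at h ⊢
    exact ⟨funext fun q => funext fun s => congrFun h.1 (q, s), h.2⟩

/-- No injection of `ℕ → Bool` into the uniform samplers (countable vs. Cantor). [folklore] -/
theorem false_of_injective_uniformSamplers (A : (ℕ → Bool) → RandAlg ℕ (List Bool))
    (hinj : Function.Injective A) (hA : ∀ a, (A a).IsPolyTime unaryEncodeNat (id : List Bool → List Bool) ∧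
      ∃ c : Polynomial ℕ, ∀ ℓ, (A a).coinLen ℓ = c.eval ℓ) : False := by
  have hc : (Set.range A).Countable := countable_uniformSamplers.mono (by rintro _ ⟨a, rfl⟩; exact hA a)
  haveI : Countable (Set.range A) := hc.to_subtype
  exact false_of_countable_natBool (Function.Injective.countable
    (f := fun a : ℕ → Bool => (⟨A a, a, rfl⟩ : Set.range A)) fun a b h => hinj (congrArg Subtype.val h))

/-! ### `stub_orbitKit` is FALSE without `P`-uniformity of the families -/

/-- **`stub_orbitKit` WITHOUT `hu₀ : IsPUniform p₀ k`, `hu₁ : IsPUniform p₁ k` is FALSE** (line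
`orbit-pair-rsr`; degree bound `DegLE 3` and the `≥ s`-outputs normalisation kept).  Witness family
(`c : ℕ → Bool`): both families the coordinate map `x ↦ (x₀, …, x_{s-1})` (degree `1`, `s` outputs), thresholds
`k_c s = [c (s-1)]`.  If a kit existed for every `c`, its planted sampler `samp false` — polynomial time with the
HONEST budget `sampCoins` — would output on `1ⁿ` (say on the all-zero coin string) an encoding of an orbit
instance of size `n+1`, whose threshold field is `k_c (n+1) = [c n]` (`samp_support`, injectivity of
`PEAInst.encoding`); so `c ↦ samp false` is injective into the countable set of uniform samplers
(`false_of_injective_uniformSamplers`) — absurd.  Hence the kit's sampler must genuinely compute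
`⟨p_b^{n+1}, k(n+1)⟩` from `1ⁿ`: a proof of `stub_orbitKit` must use `hu₀`/`hu₁` (at least for `k`).
[BogdanovTrevisan2006, Def. 2.1; AroraBarakCC2009, §6.2 (P-uniform families), §1.4] -/
theorem orbitKit_false_without_uniformity :
    ¬ ∀ (p₀ p₁ : (s : ℕ) → PolyMapF2 s) (k : ℕ → ℕ),
      (∀ s, (p₀ s).DegLE 3) → (∀ s, (p₁ s).DegLE 3) →
      (∀ s, s ≤ (p₀ s).length ∧ s ≤ (p₁ s).length) → Nonempty (OrbitKit p₀ p₁ k) := by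
  intro H
  -- the coordinate family on both sides
  let p : (s : ℕ) → PolyMapF2 s := fun s => (List.finRange s).map fun i => [[i]]
  have hdeg : ∀ s, (p s).DegLE 3 := by
    intro s q hq μ hμ
    obtain ⟨i, -, rfl⟩ := List.mem_map.1 hq
    rw [List.mem_singleton] at hμ
    subst hμ
    simp
  have hlen : ∀ s, s ≤ (p s).length ∧ s ≤ (p s).length := fun s => by simp [p]
  -- thresholds keyed by `c`
  let k : (ℕ → Bool) → ℕ → ℕ := fun c s => if c (s - 1) then 1 else 0
  have kit : ∀ c, OrbitKit p p (k c) := fun c => Classical.choice (H p p (k c) hdeg hdeg hlen)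
  -- the planted NO-sampler, run on the all-zero coin string, outputs an instance with threshold `k_c (n+1)`
  have key : ∀ c n, ∃ I : PEAInst, PEAInst.encoding.encode I =
      ((kit c).samp false).run n
        (List.replicate (((kit c).samp false).coinLen (unaryEncodeNat n).length) false) ∧
      I.2.2 = k c (n + 1) := by
    intro c n
    have hmem : ((kit c).samp false).run n
        (List.replicate (((kit c).samp false).coinLen (unaryEncodeNat n).length) false) ∈
        (((kit c).samp false).outputPMF unaryEncodeNat n).support := by
      rw [RandAlg.outputPMF, PMF.support_map, PMF.support_uniformOfFintype, Set.top_eq_univ,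
        Set.image_univ]
      exact ⟨⟨_, List.length_replicate⟩, rfl⟩
    obtain ⟨I, ⟨hI, hI1⟩, hIw⟩ := (kit c).samp_support false n _ hmem
    exact ⟨I, hIw, by rw [hI.2.1, hI1]⟩
  -- so `c ↦ samp false` is injective
  have hinj : Function.Injective fun c => (kit c).samp false := by
    intro c c' h
    have h' : (kit c).samp false = (kit c').samp false := h
    funext n
    obtain ⟨I, hI, hIk⟩ := key c n
    obtain ⟨I', hI', hIk'⟩ := key c' n
    rw [h'] at hI
    have hII' : I = I' := PEAInst.encoding.encode_injective (hI.trans hI'.symm)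
    have hk : k c (n + 1) = k c' (n + 1) := by rw [← hIk, ← hIk', hII']
    have hk' : (if c n then 1 else 0 : ℕ) = if c' n then 1 else 0 := by
      simpa [k] using hk
    cases hcn : c n <;> cases hcn' : c' n <;> simp [hcn, hcn'] at hk' ⊢
  exact false_of_injective_uniformSamplers _ hinj fun c =>
    ⟨(kit c).samp_polyTime false, (kit c).sampCoins, (kit c).samp_coinLen false⟩

/-! ### Even ONE non-uniform family breaks the kit (NO family and thresholds uniform) -/

open CodeFP in
/-- The zero family `s ↦ (0, …, 0)` (`s` outputs, every output polynomial the empty sum) with thresholds `0` is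
`P`-uniform: a `CodeFP` program on `1ˢ` (cf. the lead's `isPUniform_zeroFam`). [AroraBarakCC2009, §6.2] -/
theorem isPUniform_zeroFam_zero :
    IsPUniform (fun s => (List.replicate s ([] : List (List (Fin s))) : PolyMapF2 s)) (fun _ => 0) := by
  have hrep : CodeFP unE (rawE (listE (listE natE))) fun s => List.replicate s ([] : List (List ℕ)) :=
    (replicateOf (listE (listE natE))).comp ((const unE ([] : List (List ℕ))).pair (CodeFP.id unE))
  have hP : CodeFP unE (listE (listE (listE natE))) fun s => List.replicate s ([] : List (List ℕ)) :=
    (listOfRaw _).comp hrep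
  have hk : CodeFP unE natE fun _ : ℕ => (0 : ℕ) := const unE 0
  have h : CodeFP unE (pairE natE (pairE (listE (listE (listE natE))) natE))
      fun s => (s, (List.replicate s ([] : List (List ℕ)), (0 : ℕ))) :=
    natOfUn.pair (hP.pair hk)
  have h' : CodeFP unE PEAInst.untypedCode fun s =>
      PEAInst.untyped ⟨s, ((List.replicate s ([] : List (List (Fin s))) : PolyMapF2 s), 0)⟩ :=
    h.congr fun s => by simp [PEAInst.untyped, List.map_replicate]
  obtain ⟨f, hf, hspec⟩ := h'
  exact ⟨f, hf, fun s => by rw [PEAInst.encode_eq_untypedCode]; exact hspec s⟩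

/-- **`stub_orbitKit` is FALSE already WITHOUT `hu₁` alone** (`hu₀ : IsPUniform p₀ k` KEPT, with `p₀` the zero
family and `k = 0`; degree bound and `≥ s` outputs kept): the YES family `p₁^c (n+1) = ` coordinate map if `c n`,
zero map otherwise, is served by a kit only if `c` is determined by the uniform sampler `samp true` — its
zero-coin output at `1ⁿ` encodes a map that is CONSTANT iff it lies in the zero-map orbit iff `¬ c n` (affine
equivalence preserves constancy; a map affinely equivalent to the coordinate map separates `0` from `e₀`).  With
`countable_uniformSamplers` this is absurd for uncountably many `c`.  Symmetrically for `hu₀`.  So BOTH families'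
uniformity is used by any proof, not only the computability of `k`. [BogdanovTrevisan2006, Def. 2.1;
AroraBarakCC2009, §6.2, §1.4; Patarin1996, §2] -/
theorem orbitKit_false_without_uniformity_yes :
    ¬ ∀ (p₀ p₁ : (s : ℕ) → PolyMapF2 s) (k : ℕ → ℕ), IsPUniform p₀ k →
      (∀ s, (p₀ s).DegLE 3) → (∀ s, (p₁ s).DegLE 3) →
      (∀ s, s ≤ (p₀ s).length ∧ s ≤ (p₁ s).length) → Nonempty (OrbitKit p₀ p₁ k) := by
  intro H
  let Z : (s : ℕ) → PolyMapF2 s := fun s => List.replicate s []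
  let Cd : (s : ℕ) → PolyMapF2 s := fun s => (List.finRange s).map fun i => [[i]]
  -- invariants: maps in the orbit of `Z s` are constant, maps in the orbit of `Cd (s+1)` are not
  have hZconst : ∀ s (q : PolyMapF2 s), AffEquiv (Z s) q → ∀ x x', q.eval x = q.eval x' := by
    rintro s q ⟨A, b, B, c, -, -, hq⟩ x x'
    rw [hq x, hq x']
    have hz : ∀ y : Fin s → ZMod 2, (Z s).eval y = List.replicate s 0 := fun y => by
      simp [Z, PolyMapF2.eval, List.map_replicate]
    rw [hz, hz]
  have hCdnc : ∀ s (q : PolyMapF2 (s + 1)), AffEquiv (Cd (s + 1)) q →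
      q.eval 0 ≠ q.eval (Pi.single 0 1) := by
    rintro s q ⟨A, b, B, c, hA, hB, hq⟩ heq
    rw [hq, hq] at heq
    have h2 := affineOutput_injective B hB c (List.ofFn_injective heq)
    have hev : ∀ y : Fin (s + 1) → ZMod 2, (Cd (s + 1)).eval y = (List.finRange (s + 1)).map y := fun y => by
      simp [Cd, PolyMapF2.eval]
    have hcoord : ∀ (y : Fin (s + 1) → ZMod 2) (i : Fin (s + 1)),
        ((Cd (s + 1)).eval y).getD i 0 = y i := by
      intro y i
      have hi := i.is_lt
      rw [hev, List.getD_eq_getElem _ _ (by simp; omega)]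
      simp
    have h3 : A.mulVec 0 + b = A.mulVec (Pi.single 0 1) + b := by
      funext i
      have hi : (i : ℕ) < (Cd (s + 1)).length := by have := i.is_lt; simp [Cd]; omega
      have := congr_fun h2 ⟨i, hi⟩
      simp only at this
      rwa [hcoord, hcoord] at this
    obtain ⟨e, he⟩ := exists_equiv_affineInput A hA b
    have h4 : (0 : Fin (s + 1) → ZMod 2) = Pi.single 0 1 := e.injective (by rw [he, he]; exact h3)
    have h5 := congr_fun h4 0
    simp at h5
  -- the families
  have hdegZ : ∀ s, (Z s).DegLE 3 := by
    intro s p hp μ hμ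
    rw [List.eq_of_mem_replicate hp] at hμ
    exact absurd hμ List.not_mem_nil
  have hdegCd : ∀ s, (Cd s).DegLE 3 := by
    intro s p hp μ hμ
    obtain ⟨i, -, rfl⟩ := List.mem_map.1 hp
    rw [List.mem_singleton] at hμ
    subst hμ
    simp
  let P : (ℕ → Bool) → (s : ℕ) → PolyMapF2 s := fun c s => if c (s - 1) then Cd s else Z s
  have hdegP : ∀ c s, (P c s).DegLE 3 := by
    intro c s
    simp only [P]
    split_ifs
    exacts [hdegCd s, hdegZ s]
  have hlenP : ∀ c s, s ≤ (Z s).length ∧ s ≤ (P c s).length := by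
    intro c s
    simp only [P]
    split_ifs <;> simp [Z, Cd]
  have kit : ∀ c, OrbitKit Z (P c) (fun _ => 0) := fun c =>
    Classical.choice (H Z (P c) (fun _ => 0) isPUniform_zeroFam_zero hdegZ (hdegP c) (hlenP c))
  -- the planted YES-sampler, run on the all-zero coins at `1ⁿ`, encodes a map that is constant iff `¬ c n`
  have key : ∀ c n, ∃ I : PEAInst, PEAInst.encoding.encode I =
      ((kit c).samp true).run n
        (List.replicate (((kit c).samp true).coinLen (unaryEncodeNat n).length) false) ∧
      ((∀ x x', I.2.1.eval x = I.2.1.eval x') ↔ c n = false) := by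
    intro c n
    have hmem : ((kit c).samp true).run n
        (List.replicate (((kit c).samp true).coinLen (unaryEncodeNat n).length) false) ∈
        (((kit c).samp true).outputPMF unaryEncodeNat n).support := by
      rw [RandAlg.outputPMF, PMF.support_map, PMF.support_uniformOfFintype, Set.top_eq_univ,
        Set.image_univ]
      exact ⟨⟨_, List.length_replicate⟩, rfl⟩
    obtain ⟨I, ⟨hI, hI1⟩, hIw⟩ := (kit c).samp_support true n _ hmem
    refine ⟨I, hIw, ?_⟩
    obtain ⟨s, q, j⟩ := I
    dsimp only at hI1
    subst hI1
    have haff : AffEquiv (P c (n + 1)) q := hI.2.2.2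
    simp only [P, Nat.add_sub_cancel] at haff
    cases hc : c n
    · rw [hc] at haff
      simp only [Bool.false_eq_true, if_false] at haff
      exact ⟨fun _ => rfl, fun _ => hZconst _ q haff⟩
    · rw [hc] at haff
      simp only [if_true] at haff
      exact ⟨fun hconst => absurd (hconst 0 (Pi.single 0 1)) (hCdnc n q haff), fun h => absurd h (by decide)⟩
  -- so `c ↦ samp true` is injective
  have hinj : Function.Injective fun c => (kit c).samp true := by
    intro c c' h
    have h' : (kit c).samp true = (kit c').samp true := h
    funext n
    obtain ⟨I, hI, hIc⟩ := key c n
    obtain ⟨I', hI', hIc'⟩ := key c' n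
    rw [h'] at hI
    have hII' : I = I' := PEAInst.encoding.encode_injective (hI.trans hI'.symm)
    subst hII'
    have hiff : c n = false ↔ c' n = false := hIc.symm.trans hIc'
    cases hcn : c n <;> cases hcn' : c' n <;> simp_all
  exact false_of_injective_uniformSamplers _ hinj fun c =>
    ⟨(kit c).samp_polyTime true, (kit c).sampCoins, (kit c).samp_coinLen true⟩

end Summit.PneNP.PneNP.Theorems
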